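import Summits.QuantumAdvantage.QuantumAdvantage.Theorems.LinnikCubicClassGroupsDegreeOnePrimesEscapeConjClassIntervalsAll
import HarnessLib

/-!
# The least prime with a prescribed Frobenius ELEMENT — every element, generators included

Topic `Summits/QuantumAdvantage/QuantumAdvantage/Theorems`, cell B2b-1 (linnik-cubic), PART A (gen 13); helper
toward the crux `DegreeOnePrimesEscape` (stmt-QuantumAdvantage-11543).  HONEST FRAMING: the value of this file is
a THEOREM (kernel-checked, GRH-free) — NOT summit progress.

`exists_prime_isArithFrobAt_le_discr_rpow` (`…ChebotarevElement.lean`, gen 12) is Lagarias–Montgomery–Odlyzko's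
Theorem 1.1 for the conjugacy class of an element `σ` NOT generating `Gal(N/ℚ)`.  With the base-field-free chain
of gen 13 (`frobeniusClass_PNT_all`, `exists_frobenius_isConj_mem_Ioc_all`) the restriction disappears:

**Theorem** (`exists_prime_isArithFrobAt_le_all`).  For `n > 1` there is `L = L(n) > 0` such that for every Galois
number field `N` of degree `n` and EVERY `σ ∈ Gal(N/ℚ)` there is a prime `p ∤ d_N`, `p ≤ |d_N|^{L}`, and a prime
`𝔔 ∣ p` of `N` at which `σ` is an arithmetic Frobenius: `Frob_p ∈ C(σ)` — [LagariasMontgomeryOdlyzko1979,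
Theorem 1.1], unconditional, inexplicit `L`.  (Indeed such primes exist in every interval `(x, 2x]`,
`x ≥ |d_N|^{L}`: `exists_prime_isArithFrobAt_mem_Ioc_all`.)
-/

noncomputable section

open scoped NumberField nonZeroDivisors Pointwise
open Finset Real Ideal NumberField
open Literature.NumberTheory.NumberFields Literature.NumberTheory.LFunctions
  Literature.NumberTheory.LFunctions.NumberField

namespace Summit.QuantumAdvantage.QuantumAdvantage.Theorems.DegreeOnePrimesEscape

variable {N : Type} [Field N] [NumberField N] [IsGalois ℚ N]

omit [IsGalois ℚ N] in
/-- From the class predicate to `σ` itself: if `φ` is an arithmetic Frobenius at `Q ∣ p` and `g φ g⁻¹ = σ`,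
then `σ` is an arithmetic Frobenius at the prime `g Q ∣ p`. -/
theorem exists_isArithFrobAt_of_conj {p : ℕ} (hp : p.Prime) {Q : Ideal (𝓞 N)} (hQ : Q.IsMaximal)
    (hQp : Q.LiesOver (span {(p : ℤ)})) {φ g σ : N ≃ₐ[ℚ] N} (hφ : IsArithFrobAt ℤ φ Q) (hg : g * φ * g⁻¹ = σ) :
    ∃ Q' : Ideal (𝓞 N), Q'.IsMaximal ∧ Q'.LiesOver (span {(p : ℤ)}) ∧ IsArithFrobAt ℤ σ Q' := by
  haveI := hQ
  haveI := hQp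
  have hp0 : (span {(p : ℤ)}) ≠ ⊥ := by
    rw [Ne, span_singleton_eq_bot]; exact_mod_cast hp.ne_zero
  refine ⟨g • Q, ?_, inferInstance, ?_⟩
  · exact Ideal.IsPrime.isMaximal inferInstance (ne_bot_of_liesOver_of_ne_bot hp0 _)
  · rw [← hg]; exact hφ.conj g

open scoped Classical in
/-- **Primes with a prescribed Frobenius element in every interval `(x, 2x]`, `x ≥ |d_N|^L`, every `σ`.**
[cite: LagariasMontgomeryOdlyzko1979, Theorem 1.1] -/
theorem exists_prime_isArithFrobAt_mem_Ioc_all (n : ℕ) (hn : 1 < n) :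
    ∃ L : ℝ, 0 < L ∧ ∀ (N : Type) [Field N] [NumberField N] [IsGalois ℚ N],
      Module.finrank ℚ N = n → ∀ σ : N ≃ₐ[ℚ] N, ∀ x : ℝ, ((NumberField.discr N).natAbs : ℝ) ^ L ≤ x →
        ∃ p : ℕ, p.Prime ∧ x < p ∧ (p : ℝ) ≤ 2 * x ∧ ¬ ((p : ℤ) ∣ NumberField.discr N) ∧
          ∃ Q : Ideal (𝓞 N), Q.IsMaximal ∧ Q.LiesOver (span {(p : ℤ)}) ∧ IsArithFrobAt ℤ σ Q := by
  obtain ⟨L, hL, h⟩ := exists_frobenius_isConj_mem_Ioc_all n hn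
  refine ⟨L, hL, fun N _ _ _ hN σ x hx => ?_⟩
  obtain ⟨p, hp, hxp, hp2, hnd, Q, hQmax, hQover, φ, g, hφ, -, hg⟩ := h N hN σ x hx
  exact ⟨p, hp, hxp, hp2, hnd, exists_isArithFrobAt_of_conj hp hQmax hQover hφ hg⟩

open scoped Classical in
/-- **The least prime with a prescribed Frobenius element, every element** (Lagarias–Montgomery–Odlyzko's
Theorem 1.1, unconditional): for `n > 1` there is `L > 0` such that for every Galois `N` of degree `n` and
every `σ ∈ Gal(N/ℚ)` some prime `p ≤ |d_N|^L`, `p ∤ d_N`, has a prime `𝔔 ∣ p` with `Frob_𝔔 = σ`.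
[cite: LagariasMontgomeryOdlyzko1979, Theorem 1.1] -/
theorem exists_prime_isArithFrobAt_le_all (n : ℕ) (hn : 1 < n) :
    ∃ L : ℝ, 0 < L ∧ ∀ (N : Type) [Field N] [NumberField N] [IsGalois ℚ N],
      Module.finrank ℚ N = n → ∀ σ : N ≃ₐ[ℚ] N,
        ∃ p : ℕ, p.Prime ∧ (p : ℝ) ≤ ((NumberField.discr N).natAbs : ℝ) ^ L ∧ ¬ ((p : ℤ) ∣ NumberField.discr N) ∧
          ∃ Q : Ideal (𝓞 N), Q.IsMaximal ∧ Q.LiesOver (span {(p : ℤ)}) ∧ IsArithFrobAt ℤ σ Q := by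
  obtain ⟨L₀, hL₀, h⟩ := exists_prime_isArithFrobAt_mem_Ioc_all n hn
  refine ⟨L₀ + 1, by linarith, fun N _ _ _ hN σ => ?_⟩
  have hN1 : 1 < Module.finrank ℚ N := by rw [hN]; exact hn
  set d : ℝ := ((NumberField.discr N).natAbs : ℝ) with hd
  have hd3 : (3 : ℝ) ≤ d := three_le_natAbs_discr_real N hN1
  have hd0 : (0 : ℝ) < d := by linarith
  obtain ⟨p, hp, -, hp2, hnd, hQ⟩ := h N hN σ (d ^ L₀) le_rfl
  refine ⟨p, hp, hp2.trans ?_, hnd, hQ⟩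
  rw [Real.rpow_add hd0, Real.rpow_one, mul_comm]
  exact mul_le_mul_of_nonneg_left (by linarith) (Real.rpow_nonneg hd0.le _)

end Summit.QuantumAdvantage.QuantumAdvantage.Theorems.DegreeOnePrimesEscape

end
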